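import Literature.AlgebraicGeometry.Resolution.SmoothDescentField
import Literature.AlgebraicGeometry.Resolution.RegularLocalRingsFlatDescent
import Mathlib.RingTheory.Smooth.Fiber
import HarnessLib

/-!
# Descent of smoothness through flat covers (Stacks 05B5 for `q` of finite presentation; 05AX; 02JZ)

Topic: `Literature/AlgebraicGeometry/Resolution`. The named fact `Stacks05B5`
(`InseparableLocalUniformizationLemmas.lean`; The Stacks Project, Tag 05B5: for `X → Y → S` with
`f : X → Y` surjective, flat and locally of finite presentation and `p : X → S` smooth, the
morphism `q : Y → S` is smooth) is proved in the tree only for SMOOTH covers `f`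
(`smooth_of_smooth_cover`, `SmoothDescent.lean`) and, pointwise over a field, again for smooth
covers (`isSmoothAt_comap_of_smooth_of_field`, `SmoothDescentField.lean`). The printed proof of
Tag 05B5 has four steps: (1) `q` is locally of finite presentation (Tag 02KL, algebra form
Tag 02KK — descent of finite presentation along faithfully flat ring maps of finite
presentation, which rests on the limit theorem Tag 02JO and is NOT in Mathlib or in this tree);
(2) `q` is flat (Tag 02JZ); (3) by the fibrewise criterion of smoothness (Tags 01V8/00TF, Mathlib's
`Algebra.Smooth.of_formallySmooth_fiber`) it suffices that the fibres of `q` are smooth; (4) over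
a field, smoothness descends along flat surjective morphisms (Varieties, Tag 05AX, through descent
of geometric regularity, Tag 05AW, and "smooth ⇔ geometrically regular", Tag 038V). This file
PROVES steps (2)–(4) and hence Tag 05B5 for FLAT (not necessarily smooth) covers whenever the
conclusion of step (1) is known, i.e. when `Y → S` is already of finite presentation:

* `flat_of_faithfullyFlat_of_flat` — **Tag 02JZ**, affine: `Λ → R → S` with `S` faithfully flat
  over `R` and flat over `Λ` ⇒ `R` flat over `Λ`.
* `isRegularLocalRing_baseChange_of_flat`, `isSmoothAt_baseChange_of_flat` — the flat-cover
  versions of `isRegularLocalRing_baseChange_of_smooth_cover` / `isSmoothAt_baseChange_of_smooth_cover`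
  (`SmoothBaseChangeField.lean`): regularity is transported DOWN a flat local homomorphism by
  Matsumura's Thm. 23.7 (i) (`IsRegularLocalRing.of_flat_of_isLocalHom`,
  `RegularLocalRingsFlatDescent.lean`) instead of EGA IV₄ 17.5.8 (iii).
* `isSmoothAt_comap_of_flat_of_field` — **Tag 05AX, pointwise**: for `A`, `D` of finite type
  over a field `l`, `D` flat over `A` and `l`-smooth at a prime `r`, `A` is `l`-smooth at `r ∩ A`
  (printed: "If `X → Spec(k)` is smooth at `x` and `f` is flat at `x` then `Y → Spec(k)` is
  smooth at `y`"; here `f` flat).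
* `smooth_of_faithfullyFlat_of_field` — **Tag 05AX, global** ("In particular, if `X` is smooth
  over `k` and `f` is flat and surjective, then `Y` is smooth over `k`"), affine.
* `smooth_of_faithfullyFlat_of_finitePresentation` — **Tag 05B5 for flat covers, `R/Λ` of finite
  presentation**: `Λ → R → S`, `S` faithfully flat of finite presentation over `R` and smooth
  over `Λ`, `R` of finite presentation over `Λ` ⇒ `R` smooth over `Λ`.
* `Stacks05B5.of_finitePresentation_descent` — the named fact `Stacks05B5` follows from the
  statement of Tag 02KK (descent of finite presentation), which is exactly what remains.

## Sources

* The Stacks Project, Tags 05B5, 02JZ, 00TF/01V8, 05AX (with 05AW, 038V, 00TV), 02KK.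
* H. Matsumura, *Commutative Ring Theory*, CUP 1986, Thm. 23.7 (i).
-/

noncomputable section

namespace Literature.AlgebraicGeometry.Resolution

universe u

open IsLocalRing TensorProduct

/-! ### Tag 02JZ: flatness descends through a faithfully flat cover of the source -/

/-- **Flatness descends through a faithfully flat cover** (The Stacks Project, Tag 02JZ: "Let
`X → Y → S`, `f : X → Y` surjective and flat, `p : X → S` flat. Then `q : Y → S` is flat."),
affine: for `Λ → R → S` with `S` faithfully flat over `R` and flat over `Λ`, `R` is flat over
`Λ` — for an injective `Λ`-linear `f`, `R ⊗_Λ f` is injective iff `S ⊗_R (R ⊗_Λ f) ≅ S ⊗_Λ f`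
is. [cite: StacksProject, Tag 02JZ] -/
theorem flat_of_faithfullyFlat_of_flat (Λ R S : Type*) [CommRing Λ] [CommRing R] [CommRing S]
    [Algebra Λ R] [Algebra Λ S] [Algebra R S] [IsScalarTower Λ R S]
    [Module.FaithfullyFlat R S] [Module.Flat Λ S] : Module.Flat Λ R := by
  rw [Module.Flat.iff_lTensor_preserves_injective_linearMap]
  intro N P _ _ _ _ f hf
  have h1 : Function.Injective ((f.baseChange R).lTensor S) := by
    let eN := TensorProduct.AlgebraTensorModule.cancelBaseChange Λ R S S N
    let eP := TensorProduct.AlgebraTensorModule.cancelBaseChange Λ R S S P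
    have hcomm : ∀ t, eP ((f.baseChange R).lTensor S t) = f.lTensor S (eN t) := by
      intro t
      induction t using TensorProduct.induction_on with
      | zero => simp
      | add x y hx hy => simp [hx, hy]
      | tmul s v =>
        induction v using TensorProduct.induction_on with
        | zero => simp
        | add x y hx hy =>
          simp only [LinearMap.lTensor_tmul, map_add, tmul_add] at hx hy ⊢
          rw [hx, hy]
        | tmul c n => simp [eN, eP]
    intro x y hxy
    have key : f.lTensor S (eN x) = f.lTensor S (eN y) := by rw [← hcomm, ← hcomm, hxy]
    exact eN.injective (Module.Flat.lTensor_preserves_injective_linearMap f hf key)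
  have h2 : Function.Injective (f.baseChange R) :=
    (Module.FaithfullyFlat.lTensor_injective_iff_injective R S (f.baseChange R)).mp h1
  rwa [LinearMap.baseChange_eq_ltensor] at h2

/-! ### Regularity and smoothness after a purely inseparable extension of the constants, along a flat cover -/

section FlatCover

variable (l l' : Type u) [Field l] [Field l'] [Algebra l l'] [IsPurelyInseparable l l']
  (X : Type u) [CommRing X] [Algebra l X] [Algebra.FiniteType l X]
  (D : Type u) [CommRing D] [Algebra X D] [Algebra l D] [IsScalarTower l X D]
  [Algebra.FiniteType l D] [Module.Flat X D]
  (r : Ideal D) [r.IsPrime] [Algebra.IsSmoothAt l r]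

/-- **Regularity at the image of a smooth point of a FLAT cover, after enlarging the
constants** (the regularity half of The Stacks Project, Tag 05AX/05AW): `X = Spec A` and
`Z = Spec D` of finite type over the field `l`, `Z → X` flat, `z ∈ Z` a point at which `Z` is
`l`-smooth, `x` its image, `l′/l` purely inseparable. Then `X_{l′} = Spec(l′ ⊗_l A)` is REGULAR
at its (unique) point `x′` over `x`: `Z_{l′} → X_{l′}` is flat (base change), `Z_{l′}` is
`l′`-smooth at the point `z′` over `z` (`isSmoothAt_baseChange`), hence regular there
(`isRegularLocalRing_of_isSmoothAt`), and regularity descends along the flat local homomorphism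
`𝒪_{X_{l′},x′} → 𝒪_{Z_{l′},z′}` (Matsumura, Thm. 23.7 (i), `IsRegularLocalRing.of_flat_of_isLocalHom`).
[cite: StacksProject, Tag 05AW] -/
theorem isRegularLocalRing_baseChange_of_flat
    (x' : Ideal (l' ⊗[l] X)) [x'.IsPrime]
    (hx' : x'.comap (Algebra.TensorProduct.includeRight (R := l) (A := l') :
        X →ₐ[l] l' ⊗[l] X).toRingHom = r.comap (algebraMap X D)) :
    IsRegularLocalRing (Localization.AtPrime x') := by
  classical
  let φ : X →ₐ[l] D := IsScalarTower.toAlgHom l X D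
  let ψ : l' ⊗[l] X →ₐ[l'] l' ⊗[l] D := Algebra.TensorProduct.map (AlgHom.id l' l') φ
  letI : Algebra (l' ⊗[l] X) (l' ⊗[l] D) := ψ.toRingHom.toAlgebra
  haveI : IsScalarTower l' (l' ⊗[l] X) (l' ⊗[l] D) :=
    IsScalarTower.of_algebraMap_eq fun c => (ψ.commutes c).symm
  have hψ : ∀ a : X, algebraMap (l' ⊗[l] X) (l' ⊗[l] D) ((1 : l') ⊗ₜ[l] a) =
      (1 : l') ⊗ₜ[l] (algebraMap X D a) := fun a => by
    change ψ ((1 : l') ⊗ₜ[l] a) = _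
    simp [ψ, φ]
  -- `l′ ⊗ D` is flat over `l′ ⊗ X` (pasting of pushouts)
  haveI : Module.Flat (l' ⊗[l] X) (l' ⊗[l] D) := by
    letI : Algebra X (l' ⊗[l] X) := Algebra.TensorProduct.rightAlgebra
    letI : Algebra D (l' ⊗[l] D) := Algebra.TensorProduct.rightAlgebra
    letI : Algebra X (l' ⊗[l] D) :=
      ((algebraMap D (l' ⊗[l] D)).comp (algebraMap X D)).toAlgebra
    haveI : IsScalarTower X D (l' ⊗[l] D) := IsScalarTower.of_algebraMap_eq fun _ => rfl
    haveI : IsScalarTower X (l' ⊗[l] X) (l' ⊗[l] D) :=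
      IsScalarTower.of_algebraMap_eq fun a => (hψ a).symm
    haveI : IsScalarTower l D (l' ⊗[l] D) := IsScalarTower.of_algebraMap_eq fun c =>
      ((Algebra.TensorProduct.includeRight (R := l) (A := l') : D →ₐ[l] l' ⊗[l] D).commutes c).symm
    haveI : IsScalarTower l X (l' ⊗[l] X) := IsScalarTower.of_algebraMap_eq fun c =>
      ((Algebra.TensorProduct.includeRight (R := l) (A := l') : X →ₐ[l] l' ⊗[l] X).commutes c).symm
    haveI : IsScalarTower l (l' ⊗[l] X) (l' ⊗[l] D) := IsScalarTower.of_algebraMap_eq fun c => by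
      rw [IsScalarTower.algebraMap_apply l l' (l' ⊗[l] X),
        IsScalarTower.algebraMap_apply l l' (l' ⊗[l] D)]
      exact (ψ.commutes _).symm
    have h1 : Algebra.IsPushout l D l' (l' ⊗[l] D) := inferInstance
    have h2 : Algebra.IsPushout X D (l' ⊗[l] X) (l' ⊗[l] D) :=
      (Algebra.IsPushout.comp_iff (R := l) (S := X) (T := D) (R' := l') (S' := l' ⊗[l] X)
        (T' := l' ⊗[l] D)).mp h1
    haveI := h2.symm
    exact Module.Flat.of_linearEquiv
      (Algebra.IsPushout.equiv X (l' ⊗[l] X) D (l' ⊗[l] D)).symm.toLinearEquiv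
  -- a prime `r′` of `l′ ⊗ D` over `r`; its image is `x′`
  obtain ⟨r', hr'prime, hr'⟩ := exists_prime_comap_includeRight_eq (l := l) (l' := l') D r
  haveI := hr'prime
  have hcomm : (algebraMap (l' ⊗[l] X) (l' ⊗[l] D)).comp
      (Algebra.TensorProduct.includeRight (R := l) (A := l') : X →ₐ[l] l' ⊗[l] X).toRingHom =
      (Algebra.TensorProduct.includeRight (R := l) (A := l') : D →ₐ[l] l' ⊗[l] D).toRingHom.comp
        (algebraMap X D) := RingHom.ext fun a => hψ a
  have hx'' : (r'.under (l' ⊗[l] X)).comap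
      (Algebra.TensorProduct.includeRight (R := l) (A := l') : X →ₐ[l] l' ⊗[l] X).toRingHom =
      r.comap (algebraMap X D) := by
    rw [Ideal.under_def, Ideal.comap_comap, hcomm, ← Ideal.comap_comap, hr']
  have heq : r'.under (l' ⊗[l] X) = x' :=
    eq_of_comap_includeRight_eq (hx''.trans hx'.symm)
  subst heq
  -- `l′ ⊗ D` is `l′`-smooth at `r′`, hence regular there
  haveI : Algebra.FinitePresentation l D := (Algebra.FinitePresentation.of_finiteType).mp ‹_›
  haveI : Algebra.IsSmoothAt l' r' := isSmoothAt_baseChange l' r r' hr'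
  haveI : IsRegularLocalRing (Localization.AtPrime r') :=
    isRegularLocalRing_of_isSmoothAt l' (l' ⊗[l] D) r'
  -- Matsumura 23.7 (i) for the flat local homomorphism `(l′ ⊗ X)_{x′} → (l′ ⊗ D)_{r′}`
  set x' : Ideal (l' ⊗[l] X) := r'.under (l' ⊗[l] X) with hx'def
  set Ax := Localization.AtPrime x'
  set Dr := Localization.AtPrime r'
  letI : Algebra Ax Dr := Localization.AtPrime.algebraOfLiesOver x' r'
  haveI : IsLocalHom (algebraMap Ax Dr) := by
    rw [Localization.AtPrime.IsLiesOverAlgebra.algebraMap_eq (p := x') (P := r')]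
    infer_instance
  haveI : Module.Flat (l' ⊗[l] X) Dr := Module.Flat.trans (l' ⊗[l] X) (l' ⊗[l] D) Dr
  haveI : Module.Flat Ax Dr := (Module.flat_iff_of_isLocalization Ax x'.primeCompl Dr).mpr ‹_›
  haveI : IsNoetherianRing (l' ⊗[l] X) := Algebra.FiniteType.isNoetherianRing l' _
  haveI : IsNoetherianRing Ax := IsLocalization.isNoetherianRing x'.primeCompl Ax inferInstance
  exact IsRegularLocalRing.of_flat_of_isLocalHom Ax Dr

/-- **… and smoothness, once the residue field is separable** (The Stacks Project, Tag 05AX via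
Tag 00TV): in the situation of `isRegularLocalRing_baseChange_of_flat`, if the residue field of
`x′` is formally smooth (separable) over `l′`, then `X_{l′}` is `l′`-smooth at `x′`
(`isSmoothAt_of_isRegularLocalRing_of_formallySmooth_residueField`).
[cite: StacksProject, Tag 05AX] -/
theorem isSmoothAt_baseChange_of_flat
    (x' : Ideal (l' ⊗[l] X)) [x'.IsPrime]
    (hx' : x'.comap (Algebra.TensorProduct.includeRight (R := l) (A := l') :
        X →ₐ[l] l' ⊗[l] X).toRingHom = r.comap (algebraMap X D))
    [Algebra.FormallySmooth l' (ResidueField (Localization.AtPrime x'))] :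
    Algebra.IsSmoothAt l' x' := by
  haveI := isRegularLocalRing_baseChange_of_flat l l' X D r x' hx'
  haveI : Algebra.FinitePresentation l X := (Algebra.FinitePresentation.of_finiteType).mp ‹_›
  haveI : Algebra.FinitePresentation l' (l' ⊗[l] X) := inferInstance
  exact isSmoothAt_of_isRegularLocalRing_of_formallySmooth_residueField l' (l' ⊗[l] X) x'

end FlatCover

/-! ### Tag 05AX: over a field, smoothness descends along flat (surjective) morphisms -/

/-- **Smoothness descends along a flat morphism, at a point, over a field** (The Stacks
Project, Tag 05AX: "Let `k` be a field. Let `f : X → Y` be a morphism of schemes locally of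
finite type over `k`. Let `x ∈ X` be a point and set `y = f(x)`. If `X → Spec(k)` is smooth at
`x` and `f` is flat at `x` then `Y → Spec(k)` is smooth at `y`."), affine, with `f` flat: `A`, `D`
of finite type over the field `l`, `D` flat over `A` and `l`-smooth at the prime `r`; then `A`
is `l`-smooth at `r ∩ A`. Proof as for `isSmoothAt_comap_of_smooth_of_field`: after a finite
purely inseparable extension `l₀/l` of the constants making the residue field separable,
`l₀ ⊗ A` is regular at the point over `r ∩ A` by flat descent of regularity
(`isSmoothAt_baseChange_of_flat`), hence smooth there (Tag 00TV); a neighbourhood `D(1 ⊗ f)` in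
the smooth locus gives `l₀ ⊗ A_f` smooth, and smoothness descends along the faithfully flat
`l → l₀`. [cite: StacksProject, Tag 05AX] -/
theorem isSmoothAt_comap_of_flat_of_field (l : Type u) [Field l]
    (A : Type u) [CommRing A] [Algebra l A] [Algebra.FiniteType l A]
    (D : Type u) [CommRing D] [Algebra A D] [Algebra l D] [IsScalarTower l A D]
    [Algebra.FiniteType l D] [Module.Flat A D] (r : Ideal D) [r.IsPrime]
    [Algebra.IsSmoothAt l r] :
    Algebra.IsSmoothAt l (r.comap (algebraMap A D)) := by
  classical
  set x : Ideal A := r.comap (algebraMap A D) with hxdef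
  haveI : Algebra.FinitePresentation l A := (Algebra.FinitePresentation.of_finiteType).mp ‹_›
  -- the residue field of `x` is finitely generated over `l`
  have hfg : (⊤ : IntermediateField l x.ResidueField).FG := by
    haveI : Algebra.EssFiniteType l x.ResidueField :=
      Algebra.EssFiniteType.comp l A x.ResidueField
    exact IntermediateField.fg_top_iff.mpr this
  -- enlarge the constants so that every compositum of `κ(x)` with `l₀` is separable
  obtain ⟨l₀, _, _, hl₀fin, hl₀pi, hsep⟩ :=
    exists_purelyInseparable_formallySmooth_compositum l x.ResidueField hfg
  haveI := hl₀pi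
  haveI : Algebra.IsAlgebraic l l₀ := inferInstance
  -- the prime `x′` of `l₀ ⊗ A` over `x`; `l₀ ⊗ A` is `l₀`-smooth there
  obtain ⟨x', hx'p, hx'⟩ := exists_prime_comap_includeRight_eq (l := l) (l' := l₀) A x
  haveI := hx'p
  haveI : Algebra.FormallySmooth l₀ (ResidueField (Localization.AtPrime x')) :=
    formallySmooth_residueField_baseChange_of_compositum A x' x hx'.symm hsep
  haveI : Algebra.IsSmoothAt l₀ x' :=
    isSmoothAt_baseChange_of_flat l l₀ A D r x' (hx'.trans hxdef)
  -- a basic open `D(1 ⊗ f) ∋ x′` inside the smooth locus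
  haveI : Algebra.FinitePresentation l₀ (l₀ ⊗[l] A) := inferInstance
  obtain ⟨F, hFx', hFsm⟩ := Algebra.IsSmoothAt.exists_notMem_smooth l₀ x'
  obtain ⟨q, hq⟩ := ExpChar.exists l
  obtain ⟨n, f, hf⟩ := exists_pow_mem_range_includeRight A q F
  have hFpow : F ^ q ^ n = (1 : l₀) ⊗ₜ[l] f := hf.symm
  have hfx : f ∉ x := fun hfx => by
    apply hFx'
    apply hx'p.mem_of_pow_mem (q ^ n)
    rw [hFpow]
    have : f ∈ x'.comap (Algebra.TensorProduct.includeRight (R := l) (A := l₀) :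
        A →ₐ[l] l₀ ⊗[l] A).toRingHom := by rw [hx']; exact hfx
    exact this
  have hsub : ↑(PrimeSpectrum.basicOpen ((1 : l₀) ⊗ₜ[l] f)) ⊆
      Algebra.smoothLocus l₀ (l₀ ⊗[l] A) := by
    rw [← hFpow, PrimeSpectrum.basicOpen_pow _ _ (expChar_pow_pos l q n)]
    exact Algebra.basicOpen_subset_smoothLocus_iff_smooth.mpr hFsm
  have hsm1f : Algebra.Smooth l₀ (Localization.Away ((1 : l₀) ⊗ₜ[l] f)) :=
    Algebra.basicOpen_subset_smoothLocus_iff_smooth.mp hsub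
  -- `l₀ ⊗ A_f ≅ (l₀ ⊗ A)_{1 ⊗ f}` is smooth over `l₀`; descend along the faithfully flat `l → l₀`
  let C := Localization.Away ((1 : l₀) ⊗ₜ[l] f)
  have hmap : (Submonoid.powers f).map
      (Algebra.TensorProduct.includeRight (R := l) (A := l₀) : A →ₐ[l] l₀ ⊗[l] A) =
      Submonoid.powers ((1 : l₀) ⊗ₜ[l] f) := Submonoid.map_powers _ f
  haveI : IsLocalization ((Submonoid.powers f).map
      (Algebra.TensorProduct.includeRight (R := l) (A := l₀) : A →ₐ[l] l₀ ⊗[l] A)) C := by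
    rw [hmap]; infer_instance
  let e : l₀ ⊗[l] Localization.Away f ≃ₐ[l₀] C :=
    IsLocalization.tensorProductEquivOfMapIncludeRight l l₀ (.powers f) (Localization.Away f) C
  haveI : Algebra.Smooth l₀ C := hsm1f
  haveI : Algebra.Smooth l₀ (l₀ ⊗[l] Localization.Away f) := .of_equiv e.symm
  haveI : Algebra.Smooth l (Localization.Away f) :=
    Algebra.Smooth.of_smooth_tensorProduct_of_faithfullyFlat l₀
  -- hence `A` is `l`-smooth at `x`
  exact Algebra.basicOpen_subset_smoothLocus_iff_smooth.mpr ‹_›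
    (show (⟨x, inferInstance⟩ : PrimeSpectrum A) ∈ (PrimeSpectrum.basicOpen f : Set _) from hfx)

/-- **Smoothness descends along flat surjective morphisms over a field** (The Stacks Project,
Tag 05AX, "In particular, if `X` is smooth over `k` and `f` is flat and surjective, then `Y` is
smooth over `k`."), affine: `A` of finite type over the field `k`, `B` a faithfully flat
`A`-algebra which is smooth over `k` ⇒ `A` smooth over `k` (every prime of `A` lies under a prime
of `B`, and `isSmoothAt_comap_of_flat_of_field`). [cite: StacksProject, Tag 05AX] -/
theorem smooth_of_faithfullyFlat_of_field (k A B : Type u) [Field k] [CommRing A] [CommRing B]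
    [Algebra k A] [Algebra k B] [Algebra A B] [IsScalarTower k A B] [Algebra.FiniteType k A]
    [Module.FaithfullyFlat A B] [Algebra.Smooth k B] : Algebra.Smooth k A := by
  haveI : Algebra.FinitePresentation k A := (Algebra.FinitePresentation.of_finiteType).mp ‹_›
  haveI : Algebra.FinitePresentation k B := Algebra.Smooth.finitePresentation
  refine ⟨Algebra.smoothLocus_eq_univ_iff.mp (Set.eq_univ_iff_forall.mpr fun P ↦ ?_), ‹_›⟩
  obtain ⟨Q, hQ⟩ := PrimeSpectrum.comap_surjective_of_faithfullyFlat (A := A) (B := B) P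
  subst hQ
  haveI : Algebra.IsSmoothAt k Q.asIdeal := by
    have : Q ∈ Algebra.smoothLocus k B := by rw [Algebra.smoothLocus_eq_univ]; trivial
    exact this
  exact isSmoothAt_comap_of_flat_of_field k A B Q.asIdeal

/-! ### Tag 05B5 for flat covers, when `Y → S` is of finite presentation -/

/-- **Descent of smoothness through a flat cover of finite presentation, for `R/Λ` of finite
presentation** (The Stacks Project, Tag 05B5: "Let `X → Y → S` … Assume that (1) `f` is
surjective, flat, and locally of finite presentation, (2) `p` is smooth. Then `q` is smooth.";
affine, with the conclusion of the first step of the printed proof — `q` locally of finite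
presentation, Tag 02KL — taken as a hypothesis): for `Λ → R → S` with `S` faithfully flat of
finite presentation over `R` and smooth over `Λ`, and `R` of finite presentation over `Λ`, the
algebra `R` is smooth over `Λ`. Printed proof, steps (2)–(4): `R` is flat over `Λ` (Tag 02JZ,
`flat_of_faithfullyFlat_of_flat`); by the fibrewise criterion (Tags 01V8/00TF, Mathlib
`Algebra.Smooth.of_formallySmooth_fiber`) it suffices that each fibre `κ(𝔭) ⊗_Λ R` is smooth
over `κ(𝔭)`, and `κ(𝔭) ⊗_Λ R → κ(𝔭) ⊗_Λ S` is faithfully flat with `κ(𝔭)`-smooth target, so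
Tag 05AX (`smooth_of_faithfullyFlat_of_field`) applies. [cite: StacksProject, Tag 05B5] -/
theorem smooth_of_faithfullyFlat_of_finitePresentation (Λ R S : Type u) [CommRing Λ]
    [CommRing R] [CommRing S] [Algebra Λ R] [Algebra Λ S] [Algebra R S] [IsScalarTower Λ R S]
    [Algebra.FinitePresentation Λ R] [Module.FaithfullyFlat R S]
    [Algebra.FinitePresentation R S] [Algebra.Smooth Λ S] : Algebra.Smooth Λ R := by
  haveI : Module.Flat Λ S := inferInstance
  haveI : Module.Flat Λ R := flat_of_faithfullyFlat_of_flat Λ R S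
  refine Algebra.Smooth.of_formallySmooth_fiber (fun I _ => ?_)
  let κ := I.ResidueField
  -- the fibre `κ ⊗ R → κ ⊗ S`
  let φ : R →ₐ[Λ] S := IsScalarTower.toAlgHom Λ R S
  let ψ : κ ⊗[Λ] R →ₐ[κ] κ ⊗[Λ] S := Algebra.TensorProduct.map (AlgHom.id κ κ) φ
  letI : Algebra (κ ⊗[Λ] R) (κ ⊗[Λ] S) := ψ.toRingHom.toAlgebra
  haveI : IsScalarTower κ (κ ⊗[Λ] R) (κ ⊗[Λ] S) :=
    IsScalarTower.of_algebraMap_eq fun c => (ψ.commutes c).symm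
  have hψ : ∀ a : R, algebraMap (κ ⊗[Λ] R) (κ ⊗[Λ] S) ((1 : κ) ⊗ₜ[Λ] a) =
      (1 : κ) ⊗ₜ[Λ] (algebraMap R S a) := fun a => by
    change ψ ((1 : κ) ⊗ₜ[Λ] a) = _
    simp [ψ, φ]
  -- it is faithfully flat (pasting of pushouts)
  haveI : Module.FaithfullyFlat (κ ⊗[Λ] R) (κ ⊗[Λ] S) := by
    letI : Algebra R (κ ⊗[Λ] R) := Algebra.TensorProduct.rightAlgebra
    letI : Algebra S (κ ⊗[Λ] S) := Algebra.TensorProduct.rightAlgebra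
    letI : Algebra R (κ ⊗[Λ] S) :=
      ((algebraMap S (κ ⊗[Λ] S)).comp (algebraMap R S)).toAlgebra
    haveI : IsScalarTower R S (κ ⊗[Λ] S) := IsScalarTower.of_algebraMap_eq fun _ => rfl
    haveI : IsScalarTower R (κ ⊗[Λ] R) (κ ⊗[Λ] S) :=
      IsScalarTower.of_algebraMap_eq fun a => (hψ a).symm
    haveI : IsScalarTower Λ S (κ ⊗[Λ] S) := IsScalarTower.of_algebraMap_eq fun c =>
      ((Algebra.TensorProduct.includeRight (R := Λ) (A := κ) : S →ₐ[Λ] κ ⊗[Λ] S).commutes c).symm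
    haveI : IsScalarTower Λ R (κ ⊗[Λ] R) := IsScalarTower.of_algebraMap_eq fun c =>
      ((Algebra.TensorProduct.includeRight (R := Λ) (A := κ) : R →ₐ[Λ] κ ⊗[Λ] R).commutes c).symm
    haveI : IsScalarTower Λ (κ ⊗[Λ] R) (κ ⊗[Λ] S) := IsScalarTower.of_algebraMap_eq fun c => by
      rw [IsScalarTower.algebraMap_apply Λ κ (κ ⊗[Λ] R),
        IsScalarTower.algebraMap_apply Λ κ (κ ⊗[Λ] S)]
      exact (ψ.commutes _).symm
    have h1 : Algebra.IsPushout Λ S κ (κ ⊗[Λ] S) := inferInstance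
    have h2 : Algebra.IsPushout R S (κ ⊗[Λ] R) (κ ⊗[Λ] S) :=
      (Algebra.IsPushout.comp_iff (R := Λ) (S := R) (T := S) (R' := κ) (S' := κ ⊗[Λ] R)
        (T' := κ ⊗[Λ] S)).mp h1
    haveI := h2.symm
    exact Module.FaithfullyFlat.of_linearEquiv _ _
      (Algebra.IsPushout.equiv R (κ ⊗[Λ] R) S (κ ⊗[Λ] S)).symm.toLinearEquiv
  -- its target is `κ`-smooth, its source of finite type over `κ`
  haveI : Algebra.Smooth κ (κ ⊗[Λ] S) := inferInstance
  haveI : Algebra.FiniteType κ (κ ⊗[Λ] R) := inferInstance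
  haveI : Algebra.Smooth κ (κ ⊗[Λ] R) :=
    smooth_of_faithfullyFlat_of_field κ (κ ⊗[Λ] R) (κ ⊗[Λ] S)
  exact Algebra.Smooth.formallySmooth

/-- **Stacks 05B5 reduces to descent of finite presentation (Tag 02KK).** The named fact
`Stacks05B5` (`InseparableLocalUniformizationLemmas.lean`) follows from
`smooth_of_faithfullyFlat_of_finitePresentation` as soon as finite presentation descends along
faithfully flat ring maps of finite presentation (The Stacks Project, Tag 02KK: "Let `R → A → B`
be ring maps. Assume `R → B` is of finite presentation and `A → B` faithfully flat and of finite
presentation. Then `R → A` is of finite presentation." — the algebra form of step (1) of the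
printed proof of Tag 05B5), taken here as the hypothesis `h`.
[cite: StacksProject, Tag 05B5 (proof) and Tag 02KK] -/
theorem Stacks05B5.of_finitePresentation_descent
    (h : ∀ (Λ R S : Type u) [CommRing Λ] [CommRing R] [CommRing S] [Algebra Λ R] [Algebra Λ S]
      [Algebra R S] [IsScalarTower Λ R S], Module.FaithfullyFlat R S →
      Algebra.FinitePresentation R S → Algebra.FinitePresentation Λ S →
      Algebra.FinitePresentation Λ R) :
    Stacks05B5.{u} := by
  intro Λ R S _ _ _ _ _ _ _ hff hfp hsm
  haveI : Algebra.FinitePresentation Λ S := Algebra.Smooth.finitePresentation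
  haveI : Algebra.FinitePresentation Λ R := h Λ R S hff hfp inferInstance
  exact smooth_of_faithfullyFlat_of_finitePresentation Λ R S

end Literature.AlgebraicGeometry.Resolution

end
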